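import Literature.Geometry.ComplexHyperbolic.UnitBallU21
import Literature.Geometry.ComplexHyperbolic.UnitaryGroupU3TorusCharacters
import HarnessLib

/-!
# Characters of `U(2,1)` and `U(3)` restricted to the diagonal torus factor through `det`

For the indefinite unitary group `U(2,1) = {g ∈ GL₃(ℂ) : gᴴ J g = J}`, `J = diag(1,1,−1)`
(`Literature.Geometry.ComplexHyperbolic.BallModel.U21`) and ANY group homomorphism `χ : U(2,1) → A` into a
commutative group, the value of `χ` on a diagonal element `diag(a, b, c)` (`|a| = |b| = |c| = 1`) depends only on
the product `abc = det`:

  `map_diagU_eq_map_diagU_det : χ (diagU a b c) = χ (diagU (a * b * c) 1 1)`.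

The compact group `U(3)` (Weyl swaps only) is the sibling file `UnitaryGroupU3TorusCharacters` (imported here for the shared torus matrix `diagMat3`).

PROOF (elementary, kernel; no Lie theory): (i) compact block — the Weyl element `w₀₁` of the `U(2)`-block
conjugates `diag(a,b,c)` to `diag(b,a,c)`, so `diag(w, w⁻¹, 1) = [diag(w,1,1), w₀₁]` is a commutator and is
killed by `χ`; (ii) NON-compact block (coordinates `1, 2`, a copy of `SU(1,1) ≅ SL₂(ℝ)`): the Cayley images
`uP x`, `uM x` of the unipotents `(1 x; 0 1)`, `(1 0; x 1)` and `dB` of `diag(2, ½)` satisfy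
`dB · uP y = uP (4y) · dB`, `dB · uM (4y) = uM y · dB` and the one-parameter laws, whence `χ (uP x) = χ (uM x) = 1`
(`uP (3y) = uP (4y) · uP (y)⁻¹`); and a rotation is a product of three unipotents,
`uP a · uM s · uP a = diag(1, c + is, c − is)` for `c² + s² = 1`, `s ≠ 0`, `a = (c − 1)/s` — the Cayley image of
`R_θ = u(a) l(sin θ) u(a)` — so `χ (diag(1, z, z̄)) = 1` for every unit `z` (`z = −1` as a square); (iii)
`diag(a,b,c) = diag(abc,1,1) · diag((bc)⁻¹, bc, 1) · diag(1, c⁻¹, c)`.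

Why (Hodge-CM cell, D5-arch (b), carver ruling J-W2glob-3 step (i)): two continuous splittings of the metaplectic
cover over `U(2,1)(ℝ)` differ by a continuous character of `U(2,1)(ℝ)`; this file is the group-theoretic half of
"that character shifts every `K = U(2) × U(1)`-weight by the SAME integer `(m,m;m)`", i.e. it is `det^m` on the
torus — so that one twist `ν ∘ det` normalises the archimedean `K′`-type offsets
(`Ichino2022/SplittingTwistOffsets`).  Continuity plays no role here; that a continuous character of `U(1)` is
`z ↦ z^m` is a separate statement.

References (context only; nothing is cited as a hypothesis): H. Jacobowitz, *An Introduction to CR Structures*,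
AMS 1990, Ch. 2 §1 (the group `U(2,1)` in these coordinates); S. Gelbart, J. Rogawski, Invent. Math. 105 (1991)
p. 457, Remark (for THEIR `G` = a unitary group in three variables: two compatible splittings differ by an automorphic
character `ν₁` of `E¹` "regarded as a character of `G`" — the determinant being the only way to do so is the content
of this file, not a statement of that Remark).
-/

set_option autoImplicit false

noncomputable section

open Matrix Complex ComplexConjugate

namespace Literature.Geometry.ComplexHyperbolic

namespace BallModel

/-! ## § 0. Equality in `U(2,1)` through matrices -/

/-- Two elements of `U(2,1)` with the same matrix are equal. [folklore] -/
theorem U21.ext_mat {g h : U21} (H : mat g = mat h) : g = h :=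
  Subtype.ext (Units.ext H)

/-! ## § 1. The diagonal torus -/

/-! The diagonal matrix `diagMat3 a b c = diag(a,b,c)` and `circle_conj_mul_self'` come from the sibling file
`UnitaryGroupU3TorusCharacters`. -/

/-- A unit diagonal matrix preserves `J`. [folklore] -/
theorem diagMat_mem (a b c : Circle) : (diagMat3 a b c)ᴴ * J * diagMat3 a b c = J := by
  have ha := circle_conj_mul_self' a
  have hb := circle_conj_mul_self' b
  have hc := circle_conj_mul_self' c
  ext i j
  fin_cases i <;> fin_cases j <;>
    simp [diagMat3, J, Matrix.mul_apply, Fin.sum_univ_three, conjTranspose_apply, Matrix.diagonal_apply] <;>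
    first | exact ha | exact hb | exact hc

/-- **The diagonal torus element** `diag(a, b, c) ∈ U(2,1)`, `a, b, c ∈ U(1)`. [folklore] -/
def diagU (a b c : Circle) : U21 := mkU21 (diagMat3 a b c) (diagMat_mem a b c)

/-- Its matrix. [folklore] -/
@[simp] theorem mat_diagU (a b c : Circle) : mat (diagU a b c) = diagMat3 a b c := rfl

/-- The torus is a homomorphic image of `U(1)³`: `diag(a,b,c)·diag(a′,b′,c′) = diag(aa′, bb′, cc′)`. [folklore] -/
theorem diagU_mul (a b c a' b' c' : Circle) :
    diagU a b c * diagU a' b' c' = diagU (a * a') (b * b') (c * c') := by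
  apply U21.ext_mat
  rw [mat_mul, mat_diagU, mat_diagU, mat_diagU]
  ext i j
  fin_cases i <;> fin_cases j <;> simp [diagMat3, Matrix.mul_apply, Fin.sum_univ_three]

/-- `diag(1,1,1) = 1`. [folklore] -/
@[simp] theorem diagU_one : diagU 1 1 1 = 1 := by
  apply U21.ext_mat
  rw [mat_diagU, mat_one]
  ext i j
  fin_cases i <;> fin_cases j <;> simp [diagMat3]

/-- Inverse on the torus. [folklore] -/
theorem diagU_inv (a b c : Circle) : (diagU a b c)⁻¹ = diagU a⁻¹ b⁻¹ c⁻¹ := by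
  rw [eq_comm, ← mul_eq_one_iff_eq_inv, diagU_mul]
  simp

/-! ## § 2. The compact block: the Weyl element of `U(2) ⊂ U(2,1)` -/

/-- The Weyl element of the `U(2)`-block, `(0 1 0; −1 0 0; 0 0 1)`. [folklore] -/
def weylMat : Matrix (Fin 3) (Fin 3) ℂ := !![0, 1, 0; -1, 0, 0; 0, 0, 1]

/-- It preserves `J`. [folklore] -/
theorem weylMat_mem : weylMatᴴ * J * weylMat = J := by
  ext i j
  fin_cases i <;> fin_cases j <;>
    simp [weylMat, J, Matrix.mul_apply, Fin.sum_univ_three, conjTranspose_apply, Matrix.diagonal_apply]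

/-- The Weyl element as an element of `U(2,1)`. [folklore] -/
def weylU : U21 := mkU21 weylMat weylMat_mem

/-- **Conjugation by the Weyl element swaps the first two torus entries**: `w · diag(a,b,c) = diag(b,a,c) · w`.
[folklore] -/
theorem weylU_mul_diagU (a b c : Circle) : weylU * diagU a b c = diagU b a c * weylU := by
  apply U21.ext_mat
  rw [mat_mul, mat_mul, mat_diagU, mat_diagU]
  change weylMat * diagMat3 a b c = diagMat3 b a c * weylMat
  ext i j
  fin_cases i <;> fin_cases j <;> simp [diagMat3, weylMat, Matrix.mul_apply, Fin.sum_univ_three]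

section Hom

variable {A : Type*} [CommGroup A] (χ : U21 →* A)

/-- A homomorphism to an abelian group is invariant under the Weyl swap of the first two torus entries.
[folklore] -/
theorem map_diagU_swap (a b c : Circle) : χ (diagU a b c) = χ (diagU b a c) := by
  have h := congrArg χ (weylU_mul_diagU a b c)
  rw [map_mul, map_mul, mul_comm (χ (diagU b a c))] at h
  exact mul_left_cancel h

/-- **Compact block**: `χ (diag(w, w⁻¹, 1)) = 1` (`diag(w, w⁻¹, 1)` is the commutator `[diag(w,1,1), w₀₁]`).
[folklore] -/
theorem map_diagU_self_inv_one (w : Circle) : χ (diagU w w⁻¹ 1) = 1 := by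
  have h : diagU w w⁻¹ 1 = diagU w 1 1 * diagU 1 w⁻¹ 1 := by rw [diagU_mul]; simp
  rw [h, map_mul, map_diagU_swap χ 1 w⁻¹ 1]
  have h2 : diagU w 1 1 * diagU w⁻¹ 1 1 = 1 := by rw [diagU_mul]; simp
  rw [← map_mul, h2, map_one]

end Hom

/-! ## § 3. The non-compact block: `SU(1,1) ≅ SL₂(ℝ)` in coordinates `1, 2` -/

/-- Cayley image of the upper unipotent `(1 x; 0 1)` of `SL₂(ℝ)`, placed in coordinates `1, 2`:
`blockdiag(1, (1 − ix/2, x/2; x/2, 1 + ix/2))`. [folklore] -/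
def uPMat (x : ℝ) : Matrix (Fin 3) (Fin 3) ℂ :=
  !![1, 0, 0; 0, 1 - I * x / 2, x / 2; 0, x / 2, 1 + I * x / 2]

/-- Cayley image of the lower unipotent `(1 0; x 1)`: `blockdiag(1, (1 + ix/2, x/2; x/2, 1 − ix/2))`. [folklore] -/
def uMMat (x : ℝ) : Matrix (Fin 3) (Fin 3) ℂ :=
  !![1, 0, 0; 0, 1 + I * x / 2, x / 2; 0, x / 2, 1 - I * x / 2]

/-- Cayley image of `diag(2, ½)`: the boost `blockdiag(1, (5/4, −3i/4; 3i/4, 5/4))`. [folklore] -/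
def dBMat : Matrix (Fin 3) (Fin 3) ℂ :=
  !![1, 0, 0; 0, 5 / 4, -(3 / 4) * I; 0, (3 / 4) * I, 5 / 4]

/-- `uP x` preserves `J`. [folklore] -/
theorem uPMat_mem (x : ℝ) : (uPMat x)ᴴ * J * uPMat x = J := by
  ext i j
  fin_cases i <;> fin_cases j <;>
    simp [uPMat, J, Matrix.mul_apply, Fin.sum_univ_three, conjTranspose_apply, Matrix.diagonal_apply,
      Complex.ext_iff, map_ofNat, Complex.conj_ofReal, Complex.conj_I, map_div₀, map_one, map_mul, map_add,
      map_sub] <;> ring_nf <;> simp only [and_self]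

/-- `uM x` preserves `J`. [folklore] -/
theorem uMMat_mem (x : ℝ) : (uMMat x)ᴴ * J * uMMat x = J := by
  ext i j
  fin_cases i <;> fin_cases j <;>
    simp [uMMat, J, Matrix.mul_apply, Fin.sum_univ_three, conjTranspose_apply, Matrix.diagonal_apply,
      Complex.ext_iff, map_ofNat, Complex.conj_ofReal, Complex.conj_I, map_div₀, map_one, map_mul, map_add,
      map_sub] <;> ring_nf <;> simp only [and_self]

/-- `dB` preserves `J`. [folklore] -/
theorem dBMat_mem : dBMatᴴ * J * dBMat = J := by
  ext i j
  fin_cases i <;> fin_cases j <;>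
    simp [dBMat, J, Matrix.mul_apply, Fin.sum_univ_three, conjTranspose_apply, Matrix.diagonal_apply,
      Complex.ext_iff, map_ofNat, Complex.conj_I, map_div₀, map_one, map_mul, map_neg] <;> norm_num

/-- The upper unipotent one-parameter family in `U(2,1)`. [folklore] -/
def uP (x : ℝ) : U21 := mkU21 (uPMat x) (uPMat_mem x)

/-- The lower unipotent one-parameter family in `U(2,1)`. [folklore] -/
def uM (x : ℝ) : U21 := mkU21 (uMMat x) (uMMat_mem x)

/-- The boost `dB ∈ U(2,1)`. [folklore] -/
def dB : U21 := mkU21 dBMat dBMat_mem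

/-- Matrix of `uP x`. [folklore] -/
@[simp] theorem mat_uP (x : ℝ) : mat (uP x) = uPMat x := rfl
/-- Matrix of `uM x`. [folklore] -/
@[simp] theorem mat_uM (x : ℝ) : mat (uM x) = uMMat x := rfl
/-- Matrix of `dB`. [folklore] -/
@[simp] theorem mat_dB : mat dB = dBMat := rfl

/-- One-parameter law `uP (x + y) = uP x · uP y`. [folklore] -/
theorem uP_add (x y : ℝ) : uP (x + y) = uP x * uP y := by
  apply U21.ext_mat
  rw [mat_mul, mat_uP, mat_uP, mat_uP]
  ext i j
  fin_cases i <;> fin_cases j <;>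
    simp [uPMat, Matrix.mul_apply, Fin.sum_univ_three, Complex.ext_iff] <;> ring_nf

/-- One-parameter law `uM (x + y) = uM x · uM y`. [folklore] -/
theorem uM_add (x y : ℝ) : uM (x + y) = uM x * uM y := by
  apply U21.ext_mat
  rw [mat_mul, mat_uM, mat_uM, mat_uM]
  ext i j
  fin_cases i <;> fin_cases j <;>
    simp [uMMat, Matrix.mul_apply, Fin.sum_univ_three, Complex.ext_iff] <;> ring_nf

/-- `uP 0 = 1`. [folklore] -/
@[simp] theorem uP_zero : uP 0 = 1 := by
  apply U21.ext_mat
  rw [mat_uP, mat_one]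
  ext i j
  fin_cases i <;> fin_cases j <;> simp [uPMat]

/-- `uM 0 = 1`. [folklore] -/
@[simp] theorem uM_zero : uM 0 = 1 := by
  apply U21.ext_mat
  rw [mat_uM, mat_one]
  ext i j
  fin_cases i <;> fin_cases j <;> simp [uMMat]

/-- **The boost dilates the upper unipotents by `4`**: `dB · uP y = uP (4y) · dB` (Cayley image of
`diag(2,½) (1 y; 0 1) = (1 4y; 0 1) diag(2,½)`). [folklore] -/
theorem dB_mul_uP (y : ℝ) : dB * uP y = uP (4 * y) * dB := by
  apply U21.ext_mat
  rw [mat_mul, mat_mul, mat_dB, mat_uP, mat_uP]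
  ext i j
  fin_cases i <;> fin_cases j <;>
    simp [uPMat, dBMat, Matrix.mul_apply, Fin.sum_univ_three, Complex.ext_iff] <;> ring_nf

/-- **The boost contracts the lower unipotents by `4`**: `dB · uM (4y) = uM y · dB`. [folklore] -/
theorem dB_mul_uM (y : ℝ) : dB * uM (4 * y) = uM y * dB := by
  apply U21.ext_mat
  rw [mat_mul, mat_mul, mat_dB, mat_uM, mat_uM]
  ext i j
  fin_cases i <;> fin_cases j <;>
    simp [uMMat, dBMat, Matrix.mul_apply, Fin.sum_univ_three, Complex.ext_iff] <;> ring_nf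

/-- **A rotation is a product of three unipotents**: for `a s = c − 1` and `a (c + 1) = −s` (both hold for
`c² + s² = 1`, `s ≠ 0`, `a = (c − 1)/s`), `uP a · uM s · uP a = diag(1, c + is, c − is)` — the Cayley image of
`R = u(a) l(s) u(a)` in `SL₂(ℝ)`. [folklore] -/
theorem uPMat_mul_uMMat_mul_uPMat (a c s : ℝ) (ha : a * s = c - 1) (hac : a * (c + 1) = -s) :
    uPMat a * uMMat s * uPMat a = diagMat3 1 (c + I * s) (c - I * s) := by
  have ha2 : a ^ 2 * s = a * c - a := by
    calc a ^ 2 * s = a * (a * s) := by ring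
      _ = a * c - a := by rw [ha]; ring
  ext i j
  fin_cases i <;> fin_cases j <;>
    simp [uPMat, uMMat, diagMat3, Matrix.mul_apply, Fin.sum_univ_three, Complex.ext_iff] <;> ring_nf <;>
    (try simp only [and_true]) <;>
    first
    | (constructor <;> linarith [ha, hac, ha2])
    | linarith [ha, hac, ha2]

/-- The rotation factorisation in `U(2,1)`: `uP a · uM s · uP a = diagU 1 z z⁻¹` for the unit `z = c + is`.
[folklore] -/
theorem uP_mul_uM_mul_uP (a c s : ℝ) (ha : a * s = c - 1) (hac : a * (c + 1) = -s) (z : Circle)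
    (hz : (z : ℂ) = c + I * s) : uP a * uM s * uP a = diagU 1 z z⁻¹ := by
  apply U21.ext_mat
  rw [mat_mul, mat_mul, mat_uP, mat_uM, mat_diagU, uPMat_mul_uMMat_mul_uPMat a c s ha hac]
  have hzi : ((z⁻¹ : Circle) : ℂ) = c - I * s := by
    rw [Circle.coe_inv_eq_conj, hz, map_add, Complex.conj_ofReal, map_mul, Complex.conj_I, Complex.conj_ofReal]
    ring
  rw [hzi, hz, Circle.coe_one]

section Hom

variable {A : Type*} [CommGroup A] (χ : U21 →* A)

/-- **The upper unipotents are killed**: `χ (uP x) = 1` — from `dB · uP y · dB⁻¹ = uP (4y)` and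
`uP (4y) = uP (3y) · uP y`, every `uP (3y)` is a commutator. [folklore] -/
theorem map_uP (x : ℝ) : χ (uP x) = 1 := by
  have key : ∀ y : ℝ, χ (uP (3 * y)) = 1 := by
    intro y
    have h := congrArg χ (dB_mul_uP y)
    rw [map_mul, map_mul, mul_comm (χ (uP (4 * y)))] at h
    have h4 : χ (uP (4 * y)) = χ (uP y) := (mul_left_cancel h).symm
    have hsplit : uP (4 * y) = uP (3 * y) * uP y := by rw [← uP_add]; ring_nf
    rw [hsplit, map_mul] at h4
    exact mul_right_cancel (h4.trans (one_mul _).symm)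
  have hx : x = 3 * (x / 3) := by ring
  rw [hx]
  exact key _

/-- **The lower unipotents are killed**: `χ (uM x) = 1`. [folklore] -/
theorem map_uM (x : ℝ) : χ (uM x) = 1 := by
  have key : ∀ y : ℝ, χ (uM (3 * y)) = 1 := by
    intro y
    have h := congrArg χ (dB_mul_uM y)
    rw [map_mul, map_mul, mul_comm (χ dB)] at h
    have h4 : χ (uM (4 * y)) = χ (uM y) := mul_right_cancel h
    have hsplit : uM (4 * y) = uM (3 * y) * uM y := by rw [← uM_add]; ring_nf
    rw [hsplit, map_mul] at h4
    exact mul_right_cancel (h4.trans (one_mul _).symm)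
  have hx : x = 3 * (x / 3) := by ring
  rw [hx]
  exact key _

/-- Non-compact block, generic case: `χ (diag(1, z, z⁻¹)) = 1` when `Im z ≠ 0` (the rotation is a product of
three unipotents). [folklore] -/
theorem map_diagU_one_self_inv_of_im_ne_zero (z : Circle) (hs0 : (z : ℂ).im ≠ 0) : χ (diagU 1 z z⁻¹) = 1 := by
  set c : ℝ := (z : ℂ).re with hc
  set s : ℝ := (z : ℂ).im with hs
  have hz : (z : ℂ) = c + I * s := by
    apply Complex.ext <;> simp [hc, hs]
  have hcs : c ^ 2 + s ^ 2 = 1 := by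
    have h := Circle.normSq_coe z
    rw [Complex.normSq_apply] at h
    nlinarith [h]
  have ha : (c - 1) / s * s = c - 1 := div_mul_cancel₀ _ hs0
  have hac : (c - 1) / s * (c + 1) = -s := by
    field_simp
    nlinarith [hcs]
  rw [← uP_mul_uM_mul_uP ((c - 1) / s) c s ha hac z hz, map_mul, map_mul, map_uP, map_uM, one_mul, one_mul]

/-- **Non-compact block**: `χ (diag(1, z, z⁻¹)) = 1` for EVERY unit `z` (for `z = ±1` write
`diag(1,z,z⁻¹) = diag(1, zw, (zw)⁻¹) · diag(1, w⁻¹, w)` with `w = e^{iπ/2}`). [folklore] -/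
theorem map_diagU_one_self_inv (z : Circle) : χ (diagU 1 z z⁻¹) = 1 := by
  by_cases hs0 : (z : ℂ).im = 0
  swap
  · exact map_diagU_one_self_inv_of_im_ne_zero χ z hs0
  · set w : Circle := Circle.exp (Real.pi / 2) with hw
    have hwim : (w : ℂ).im = 1 := by
      rw [hw, Circle.coe_exp, Complex.exp_ofReal_mul_I_im, Real.sin_pi_div_two]
    have hre : (z : ℂ).re ≠ 0 := by
      intro h0
      have h := Circle.normSq_coe z
      rw [Complex.normSq_apply, h0, hs0] at h
      norm_num at h
    have h1 : ((z * w : Circle) : ℂ).im ≠ 0 := by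
      rw [Circle.coe_mul, Complex.mul_im, hs0, hwim, zero_mul, add_zero, mul_one]
      exact hre
    have h2 : ((w⁻¹ : Circle) : ℂ).im ≠ 0 := by
      rw [Circle.coe_inv_eq_conj, Complex.conj_im, hwim]
      norm_num
    have hsplit : diagU 1 z z⁻¹ = diagU 1 (z * w) (z * w)⁻¹ * diagU 1 w⁻¹ (w⁻¹)⁻¹ := by
      rw [diagU_mul, one_mul, inv_inv, mul_inv, mul_assoc z w w⁻¹, mul_inv_cancel, mul_one, mul_assoc,
        mul_comm w⁻¹ w, mul_inv_cancel, mul_one]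
    rw [hsplit, map_mul, map_diagU_one_self_inv_of_im_ne_zero χ _ h1,
      map_diagU_one_self_inv_of_im_ne_zero χ _ h2, one_mul]

/-! ## § 4. Characters of `U(2,1)` on the torus factor through `det` -/

/-- **Main theorem**: for any homomorphism `χ : U(2,1) → A` to an abelian group and unit `a, b, c`,
`χ (diag(a,b,c)) = χ (diag(abc, 1, 1))` — on the diagonal torus `χ` depends only on the determinant.
[folklore] -/
theorem map_diagU_eq_map_diagU_det (a b c : Circle) : χ (diagU a b c) = χ (diagU (a * b * c) 1 1) := by
  have hsplit : diagU a b c = diagU (a * b * c) 1 1 * (diagU (b * c)⁻¹ (b * c) 1 * diagU 1 c⁻¹ c) := by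
    rw [diagU_mul, diagU_mul]
    congr 1 <;> group
  have h2 : χ (diagU (b * c)⁻¹ (b * c) 1) = 1 := by
    have := map_diagU_self_inv_one χ (b * c)⁻¹
    rwa [inv_inv] at this
  have h3 : χ (diagU 1 c⁻¹ c) = 1 := by
    have := map_diagU_one_self_inv χ c⁻¹
    rwa [inv_inv] at this
  rw [hsplit, map_mul, map_mul, h2, h3, mul_one, mul_one]

/-- The induced character of `U(1)`: `z ↦ χ (diag(z,1,1))`. [folklore] -/
def detChar : Circle →* A where
  toFun z := χ (diagU z 1 1)
  map_one' := by rw [diagU_one, map_one]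
  map_mul' z w := by rw [← map_mul, diagU_mul, mul_one]

/-- `χ` on the torus is `detChar χ ∘ det`: `χ (diag(a,b,c)) = detChar χ (abc)`. [folklore] -/
theorem map_diagU_eq_detChar (a b c : Circle) : χ (diagU a b c) = detChar χ (a * b * c) :=
  map_diagU_eq_map_diagU_det χ a b c

/-- In particular `χ` takes the same value on `diag(z,1,1)`, `diag(1,z,1)`, `diag(1,1,z)` — on the maximal
compact `K = U(2) × U(1)` the torus weights of `χ` are `(m, m; m)`-shaped. [folklore] -/
theorem map_diagU_coord_eq (z : Circle) :
    χ (diagU 1 z 1) = χ (diagU z 1 1) ∧ χ (diagU 1 1 z) = χ (diagU z 1 1) := by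
  constructor
  · rw [map_diagU_eq_map_diagU_det, one_mul, mul_one]
  · rw [map_diagU_eq_map_diagU_det, one_mul, one_mul]

end Hom


end BallModel

end Literature.Geometry.ComplexHyperbolic

end
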